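import Summits.HubbardSuperconductivity.HubbardSuperconductivity.Theorems.AnisotropyChordInsertionEntropyRoute

/-!
# Route `AnisotropyChord` / H0 rotor rung: the ONE-STATE («teleportation») ENTROPY FLOOR on the condensate
# density (theory seat `hubbard-h0-rotor-theory-1`, cycle 9, memo ROTOR-THEORY-9 §130; Sketch9 Part C ported,
# work-order W13)

For a non-negative amplitude `a` on hard-core configurations (`σ x = 0` ⇔ particle at `x`):

* `pairCorr a x y = G(x,y) = ⟨b_x ψ, b_y ψ⟩ = Σ_{τ : τ x = τ y = 1} ψ(τ+x) ψ(τ+y)` and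
  `lowerNormSq_eq_sum_pairCorr : ‖S⁻_tot ψ‖² = Σ_{x,y} G(x,y)`;
* `pairMass a x y = a_{xy} = Σ_{τ : τ x = τ y = 1} ψ(τ+x)²` (probability of «particle at `x`, hole at `y`»)
  and the TELEPORTATION LAW `teleLaw a x y ∝ ψ(τ+x)²` on `{τ x = τ y = 1}` (law of the other particles given
  particle at `x`, hole at `y`);
* **LEMMA T′** `pairCorr_eq : G(x,y) = √(a_{xy} a_{yx}) · BC(ν_x^{(y)}, ν_y^{(x)})`, hence with the tree's
  Bhattacharyya–Jensen floor (`bhatt_ge_exp_neg_half_klDiv`) `pairCorr_ge : G(x,y) ≥ a_{xy} e^{−K/2}`;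
* the pair-mass sum rule `sum_pairMass_eq : Σ_x Σ_{y ≠ x} a_{xy} = N (|V| − N)` on the `N`-sector with
  `Σ ψ² = 1`, and `pairMass_sub_pairMass : a_{xy} − a_{yx} = ρ_x − ρ_y`;
* **THEOREM E-FLOOR′** `condensateDensity_ge_of_teleEntropy` (and the uniform-density form `'`):
  `n₀/|V| ≥ (N/|V|)(1 − N/|V|) · exp(−K/2)` whenever `KL(ν_x^{(y)} ‖ ν_y^{(x)}) ≤ K` for all `x ≠ y`.

One state, one sector, no chemical potential, no second Perron amplitude (contrast the two-state E-FLOOR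
`condensateDensity_ge_of_entropy` of `…InsertionEntropyRoute`).  ODLRO for stoquastic states ⟺ the `N − 1`
spectators cannot tell in relative entropy where the tagged particle is.  No Hamiltonian enters this file.
-/

set_option linter.dupNamespace false

noncomputable section

open Finset

namespace Summit.HubbardSuperconductivity.HubbardSuperconductivity.Theorems.AnisotropyChord.InsertionEntropy

section OneState

variable {V : Type} [Fintype V] [DecidableEq V]

/-- Pair correlator `G(x,y) = ⟨b_x ψ, b_y ψ⟩ = Σ_{τ : τ x = τ y = 1} ψ(τ + x) ψ(τ + y)` on real amplitudes.
(theory seat `hubbard-h0-rotor-theory-1`, memo ROTOR-THEORY-9 §130) [folklore] -/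
def pairCorr (a : (V → Fin 2) → ℝ) (x y : V) : ℝ :=
  ∑ τ, if τ x = 1 ∧ τ y = 1 then a (Function.update τ x 0) * a (Function.update τ y 0) else 0

/-- Pair mass `a_{xy} = Σ_{τ : τ x = τ y = 1} ψ(τ + x)²` (= `P(x occupied, y empty)` for `x ≠ y`).
(theory seat `hubbard-h0-rotor-theory-1`, memo ROTOR-THEORY-9 §130) [folklore] -/
def pairMass (a : (V → Fin 2) → ℝ) (x y : V) : ℝ :=
  ∑ τ, if τ x = 1 ∧ τ y = 1 then a (Function.update τ x 0) ^ 2 else 0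

/-- TELEPORTATION LAW `ν_x^{(y)}(τ) = ψ(τ + x)² / a_{xy}` on `{τ : τ x = τ y = 1}`: the law of the other
particles given «particle at `x`, hole at `y`» (junk value `0` off the support and when `a_{xy} = 0`).
(theory seat `hubbard-h0-rotor-theory-1`, memo ROTOR-THEORY-9 §130) [folklore] -/
def teleLaw (a : (V → Fin 2) → ℝ) (x y : V) (τ : V → Fin 2) : ℝ :=
  if τ x = 1 ∧ τ y = 1 then a (Function.update τ x 0) ^ 2 / pairMass a x y else 0

omit [DecidableEq V] in
/-- Product of two indicator-weighted reals is the indicator of the conjunction. [folklore] -/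
theorem ite_and_mul (P Q : Prop) [Decidable P] [Decidable Q] (u v : ℝ) :
    (if P then u else 0) * (if Q then v else 0) = if P ∧ Q then u * v else 0 := by
  by_cases hP : P <;> by_cases hQ : Q <;> simp [hP, hQ]

/-- `‖S⁻_tot ψ‖² = Σ_x Σ_y G(x,y)`. Theory seat memo ROTOR-THEORY-9 §130. [folklore] -/
theorem lowerNormSq_eq_sum_pairCorr (a : (V → Fin 2) → ℝ) :
    lowerNormSq a = ∑ x, ∑ y, pairCorr a x y := by
  unfold lowerNormSq lowerSum pairCorr
  have h1 : ∀ τ : V → Fin 2,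
      (∑ x, if τ x = 1 then a (Function.update τ x 0) else 0) ^ 2
        = ∑ x, ∑ y, (if τ x = 1 ∧ τ y = 1
            then a (Function.update τ x 0) * a (Function.update τ y 0) else 0) := by
    intro τ
    rw [sq, Finset.sum_mul_sum]
    refine Finset.sum_congr rfl fun x _ => Finset.sum_congr rfl fun y _ => ?_
    exact ite_and_mul _ _ _ _
  rw [Finset.sum_congr rfl fun τ _ => h1 τ, Finset.sum_comm]
  refine Finset.sum_congr rfl fun x _ => ?_
  rw [Finset.sum_comm]

/-- `G(x,y) ≥ 0` for non-negative amplitudes. [folklore] -/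
theorem pairCorr_nonneg (a : (V → Fin 2) → ℝ) (hN : ∀ σ, 0 ≤ a σ) (x y : V) :
    0 ≤ pairCorr a x y := by
  unfold pairCorr
  refine Finset.sum_nonneg fun τ _ => ?_
  split_ifs
  · exact mul_nonneg (hN _) (hN _)
  · exact le_rfl

/-- `a_{xy} ≥ 0`. [folklore] -/
theorem pairMass_nonneg (a : (V → Fin 2) → ℝ) (x y : V) : 0 ≤ pairMass a x y := by
  unfold pairMass
  refine Finset.sum_nonneg fun τ _ => ?_
  split_ifs
  · exact sq_nonneg _
  · exact le_rfl

/-- The teleportation law is non-negative. [folklore] -/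
theorem teleLaw_nonneg (a : (V → Fin 2) → ℝ) (x y : V) (τ : V → Fin 2) : 0 ≤ teleLaw a x y τ := by
  unfold teleLaw
  split_ifs
  · exact div_nonneg (sq_nonneg _) (pairMass_nonneg a x y)
  · exact le_rfl

/-- The teleportation law is a probability law when `a_{xy} > 0`. [folklore] -/
theorem sum_teleLaw (a : (V → Fin 2) → ℝ) (x y : V) (h : 0 < pairMass a x y) :
    ∑ τ, teleLaw a x y τ = 1 := by
  unfold teleLaw
  have h2 : ∀ τ : V → Fin 2,
      (if τ x = 1 ∧ τ y = 1 then a (Function.update τ x 0) ^ 2 / pairMass a x y else 0)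
        = (if τ x = 1 ∧ τ y = 1 then a (Function.update τ x 0) ^ 2 else 0) / pairMass a x y := by
    intro τ; split_ifs <;> simp
  rw [Finset.sum_congr rfl fun τ _ => h2 τ, ← Finset.sum_div]
  unfold pairMass at h ⊢
  exact div_self (ne_of_gt h)

/-- **LEMMA T′ (one-state tower identity).** `G(x,y) = √(a_{xy} a_{yx}) · BC(ν_x^{(y)}, ν_y^{(x)})`.
Theory seat memo ROTOR-THEORY-9 §130. [folklore] -/
theorem pairCorr_eq (a : (V → Fin 2) → ℝ) (hN : ∀ σ, 0 ≤ a σ) (x y : V)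
    (hx : 0 < pairMass a x y) (hy : 0 < pairMass a y x) :
    pairCorr a x y
      = Real.sqrt (pairMass a x y * pairMass a y x) * bhatt (teleLaw a x y) (teleLaw a y x) := by
  unfold pairCorr bhatt teleLaw
  rw [Finset.mul_sum]
  refine Finset.sum_congr rfl fun τ _ => ?_
  set p := pairMass a x y with hp
  set q := pairMass a y x with hq
  have hpq : 0 < p * q := mul_pos hx hy
  have hs : Real.sqrt (p * q) ≠ 0 := ne_of_gt (Real.sqrt_pos.mpr hpq)
  by_cases hxy : τ x = 1 ∧ τ y = 1
  · have hyx : τ y = 1 ∧ τ x = 1 := ⟨hxy.2, hxy.1⟩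
    rw [if_pos hxy, if_pos hxy, if_pos hyx]
    set A := a (Function.update τ x 0)
    set B := a (Function.update τ y 0)
    have hA : 0 ≤ A := hN _
    have hB : 0 ≤ B := hN _
    have e1 : A ^ 2 / p * (B ^ 2 / q) = (A * B) ^ 2 / (p * q) := by
      field_simp
    rw [e1, Real.sqrt_div (sq_nonneg _), Real.sqrt_sq (mul_nonneg hA hB), mul_div_assoc',
      mul_div_cancel_left₀ _ hs]
  · have hyx : ¬ (τ y = 1 ∧ τ x = 1) := fun h => hxy ⟨h.2, h.1⟩
    rw [if_neg hxy, if_neg hxy, if_neg hyx]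
    simp

/-- **Per-pair entropy floor.** With `a_{xy} = a_{yx}`, `ν_x^{(y)} ≪ ν_y^{(x)}` and
`KL(ν_x^{(y)} ‖ ν_y^{(x)}) ≤ K`:  `G(x,y) ≥ a_{xy} · e^{−K/2}`. Theory seat memo ROTOR-THEORY-9 §130. [folklore] -/
theorem pairCorr_ge (a : (V → Fin 2) → ℝ) (hN : ∀ σ, 0 ≤ a σ) (x y : V) (K : ℝ)
    (hsym : pairMass a x y = pairMass a y x)
    (hac : ∀ τ, 0 < teleLaw a x y τ → 0 < teleLaw a y x τ)
    (hK : klDiv (teleLaw a x y) (teleLaw a y x) ≤ K) :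
    pairMass a x y * Real.exp (-K / 2) ≤ pairCorr a x y := by
  rcases eq_or_lt_of_le (pairMass_nonneg a x y) with h0 | hpos
  · rw [← h0, zero_mul]; exact pairCorr_nonneg a hN x y
  · have hpos' : 0 < pairMass a y x := hsym ▸ hpos
    have hJ := bhatt_ge_exp_neg_half_klDiv (teleLaw a x y) (teleLaw a y x) (teleLaw_nonneg a x y)
      (sum_teleLaw a x y hpos) hac
    rw [pairCorr_eq a hN x y hpos hpos', ← hsym, Real.sqrt_mul_self (le_of_lt hpos)]
    refine mul_le_mul_of_nonneg_left (le_trans ?_ hJ) (le_of_lt hpos)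
    exact Real.exp_le_exp.mpr (by linarith)

/-- Reindexing hole configurations at `x` by particle configurations at `x`. [folklore] -/
theorem sum_update_reindex (x : V) (f : (V → Fin 2) → ℝ) :
    ∑ τ : V → Fin 2, (if τ x = 1 then f (Function.update τ x 0) else 0)
      = ∑ σ : V → Fin 2, (if σ x = 0 then f σ else 0) := by
  rw [← Finset.sum_filter, ← Finset.sum_filter]
  refine Finset.sum_bij' (fun τ _ => Function.update τ x 0) (fun σ _ => Function.update σ x 1)
    ?_ ?_ ?_ ?_ ?_
  · intro τ hτ; simp
  · intro σ hσ; simp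
  · intro τ hτ
    simp only [Finset.mem_filter, Finset.mem_univ, true_and] at hτ
    rw [Function.update_idem, ← hτ, Function.update_eq_self]
  · intro σ hσ
    simp only [Finset.mem_filter, Finset.mem_univ, true_and] at hσ
    rw [Function.update_idem, ← hσ, Function.update_eq_self]
  · intro τ hτ; rfl

omit [DecidableEq V] in
/-- Hole count of an `N`-particle configuration: `#{z : σ z = 1} = |V| − N`. [folklore] -/
theorem card_holes_eq (σ : V → Fin 2) (N : ℝ) (h : ((univ.filter fun z => σ z = 0).card : ℝ) = N) :
    ((univ.filter fun z => σ z = 1).card : ℝ) = (Fintype.card V : ℝ) - N := by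
  have h2 : (univ.filter fun z => σ z = 1) = (univ.filter fun z => ¬ σ z = 0) := by
    refine Finset.filter_congr fun z _ => ?_
    have : ∀ i : Fin 2, i = 1 ↔ ¬ i = 0 := by decide
    exact this (σ z)
  have h3 := Finset.card_filter_add_card_filter_not (s := (univ : Finset V)) (fun z => σ z = 0)
  rw [h2]
  rw [Finset.card_univ] at h3
  have h4 : ((univ.filter fun z => σ z = 0).card : ℝ) + ((univ.filter fun z => ¬ σ z = 0).card : ℝ)
      = (Fintype.card V : ℝ) := by exact_mod_cast h3
  rw [h] at h4
  linarith

/-- **Pair-mass sum rule.**  On the `N`-particle sector with `Σ ψ² = 1`: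
`Σ_x Σ_{y ≠ x} a_{xy} = N (|V| − N)`. Theory seat memo ROTOR-THEORY-9 §130. [folklore] -/
theorem sum_pairMass_eq (a : (V → Fin 2) → ℝ) (N : ℝ) (h1 : ∑ σ, a σ ^ 2 = 1)
    (hsect : ∀ σ, a σ ≠ 0 → ((univ.filter fun z => σ z = 0).card : ℝ) = N) :
    ∑ x, ∑ y ∈ univ.erase x, pairMass a x y = N * ((Fintype.card V : ℝ) - N) := by
  -- inner sum over y: hole count of the post-insertion configuration
  have hinner : ∀ x, ∑ y ∈ univ.erase x, pairMass a x y
      = ((Fintype.card V : ℝ) - N)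
        * ∑ τ : V → Fin 2, (if τ x = 1 then a (Function.update τ x 0) ^ 2 else 0) := by
    intro x
    unfold pairMass
    rw [Finset.sum_comm, Finset.mul_sum]
    refine Finset.sum_congr rfl fun τ _ => ?_
    by_cases hx : τ x = 1
    · -- Σ_{y ≠ x} [τ y = 1] A = A · #{y : (update τ x 0) y = 1}
      have hA : ∀ y ∈ univ.erase x, (if τ x = 1 ∧ τ y = 1 then a (Function.update τ x 0) ^ 2 else 0)
          = (if (Function.update τ x 0) y = 1 then a (Function.update τ x 0) ^ 2 else 0) := by
        intro y hy
        have hyx : y ≠ x := Finset.ne_of_mem_erase hy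
        rw [Function.update_of_ne hyx]
        simp [hx]
      rw [Finset.sum_congr rfl hA, if_pos hx]
      have hxx : (if (Function.update τ x 0) x = 1 then a (Function.update τ x 0) ^ 2 else (0:ℝ)) = 0 := by
        simp
      have hfull : ∑ y ∈ univ.erase x,
            (if (Function.update τ x 0) y = 1 then a (Function.update τ x 0) ^ 2 else (0:ℝ))
          = ∑ y, (if (Function.update τ x 0) y = 1 then a (Function.update τ x 0) ^ 2 else (0:ℝ)) := by
        rw [← Finset.sum_erase_add _ _ (Finset.mem_univ x), hxx, add_zero]
      rw [hfull, ← Finset.sum_filter, Finset.sum_const, nsmul_eq_mul]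
      by_cases hz : a (Function.update τ x 0) = 0
      · simp [hz]
      · rw [card_holes_eq _ N (hsect _ hz)]
    · have hA : ∀ y ∈ univ.erase x,
          (if τ x = 1 ∧ τ y = 1 then a (Function.update τ x 0) ^ 2 else (0:ℝ)) = 0 := by
        intro y _; simp [hx]
      rw [Finset.sum_congr rfl hA, Finset.sum_const_zero, if_neg hx, mul_zero]
  rw [Finset.sum_congr rfl fun x _ => hinner x, ← Finset.mul_sum]
  -- Σ_x Σ_{τ : τ x = 1} ψ(τ + x)² = Σ_σ ψ(σ)² · #{x : σ x = 0} = N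
  have hdens : ∑ x, ∑ τ : V → Fin 2, (if τ x = 1 then a (Function.update τ x 0) ^ 2 else 0) = N := by
    rw [Finset.sum_congr rfl fun x _ => sum_update_reindex x (fun σ => a σ ^ 2), Finset.sum_comm]
    have hσ : ∀ σ : V → Fin 2, ∑ x, (if σ x = 0 then a σ ^ 2 else (0:ℝ)) = N * a σ ^ 2 := by
      intro σ
      rw [← Finset.sum_filter, Finset.sum_const, nsmul_eq_mul]
      by_cases hz : a σ = 0
      · simp [hz]
      · rw [hsect σ hz]
    rw [Finset.sum_congr rfl fun σ _ => hσ σ, ← Finset.mul_sum, h1, mul_one]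
  rw [hdens]; ring

/-- **THEOREM E-FLOOR′ (one-state entropy floor on the condensate density).**  For a non-negative
amplitude `a` supported on the `N`-particle sector with `Σ ψ² = 1`, symmetric pair masses
`a_{xy} = a_{yx}` (e.g. uniform density), `ν_x^{(y)} ≪ ν_y^{(x)}` and
`sup_{x ≠ y} KL(ν_x^{(y)} ‖ ν_y^{(x)}) ≤ K`:
`n₀/|V| ≥ (N/|V|) (1 − N/|V|) · e^{−K/2}`.  One state, one sector, no chemical potential, no second
Perron amplitude.  (theory seat `hubbard-h0-rotor-theory-1`, memo ROTOR-THEORY-9 §130) [folklore] -/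
theorem condensateDensity_ge_of_teleEntropy [Nonempty V] (a : (V → Fin 2) → ℝ) (N K : ℝ)
    (hN : ∀ σ, 0 ≤ a σ) (h1 : ∑ σ, a σ ^ 2 = 1)
    (hsect : ∀ σ, a σ ≠ 0 → ((univ.filter fun z => σ z = 0).card : ℝ) = N)
    (hsym : ∀ x y, pairMass a x y = pairMass a y x)
    (hac : ∀ x y τ, x ≠ y → 0 < teleLaw a x y τ → 0 < teleLaw a y x τ)
    (hK : ∀ x y, x ≠ y → klDiv (teleLaw a x y) (teleLaw a y x) ≤ K) :
    (N / Fintype.card V) * (1 - N / Fintype.card V) * Real.exp (-K / 2)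
      ≤ condensateDensity a := by
  have hcard : (0 : ℝ) < (Fintype.card V : ℝ) := by exact_mod_cast Fintype.card_pos
  -- off-diagonal floor
  have hoff : ∀ x, (∑ y ∈ univ.erase x, pairMass a x y) * Real.exp (-K / 2)
      ≤ ∑ y, pairCorr a x y := by
    intro x
    rw [Finset.sum_mul]
    calc ∑ y ∈ univ.erase x, pairMass a x y * Real.exp (-K / 2)
          ≤ ∑ y ∈ univ.erase x, pairCorr a x y := by
            refine Finset.sum_le_sum fun y hy => ?_
            have hyx : y ≠ x := Finset.ne_of_mem_erase hy
            exact pairCorr_ge a hN x y K (hsym x y) (fun τ => hac x y τ hyx.symm) (hK x y hyx.symm)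
      _ ≤ ∑ y, pairCorr a x y :=
            Finset.sum_le_sum_of_subset_of_nonneg (Finset.erase_subset _ _)
              (fun y _ _ => pairCorr_nonneg a hN x y)
  have hmain : N * ((Fintype.card V : ℝ) - N) * Real.exp (-K / 2) ≤ lowerNormSq a := by
    rw [lowerNormSq_eq_sum_pairCorr, ← sum_pairMass_eq a N h1 hsect, Finset.sum_mul]
    exact Finset.sum_le_sum fun x _ => hoff x
  unfold condensateDensity
  rw [le_div_iff₀ (by positivity)]
  calc N / Fintype.card V * (1 - N / Fintype.card V) * Real.exp (-K / 2)
        * (Fintype.card V : ℝ) ^ 2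
        = N * ((Fintype.card V : ℝ) - N) * Real.exp (-K / 2) := by
          field_simp
    _ ≤ lowerNormSq a := hmain

/-- Pair mass in particle coordinates: `a_{xy} = Σ_{σ : σ x = 0, σ y = 1} ψ(σ)²` (`x ≠ y`). [folklore] -/
theorem pairMass_eq_particle (a : (V → Fin 2) → ℝ) (x y : V) (hxy : x ≠ y) :
    pairMass a x y = ∑ σ : V → Fin 2, (if σ x = 0 ∧ σ y = 1 then a σ ^ 2 else 0) := by
  unfold pairMass
  have h := sum_update_reindex x (fun σ => if σ y = 1 then a σ ^ 2 else 0)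
  have hL : ∀ τ : V → Fin 2,
      (if τ x = 1 then (if (Function.update τ x 0) y = 1 then a (Function.update τ x 0) ^ 2 else 0) else 0)
        = (if τ x = 1 ∧ τ y = 1 then a (Function.update τ x 0) ^ 2 else (0:ℝ)) := by
    intro τ
    rw [Function.update_of_ne hxy.symm]
    by_cases hx : τ x = 1 <;> by_cases hy : τ y = 1 <;> simp [hx, hy]
  have hR : ∀ σ : V → Fin 2,
      (if σ x = 0 then (if σ y = 1 then a σ ^ 2 else 0) else 0)
        = (if σ x = 0 ∧ σ y = 1 then a σ ^ 2 else (0:ℝ)) := by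
    intro σ
    by_cases hx : σ x = 0 <;> by_cases hy : σ y = 1 <;> simp [hx, hy]
  rw [Finset.sum_congr rfl fun τ _ => hL τ, Finset.sum_congr rfl fun σ _ => hR σ] at h
  exact h

/-- **Pair-mass asymmetry = density difference**: `a_{xy} − a_{yx} = ρ_x − ρ_y` (`x ≠ y`); in particular
uniform site density makes the pair masses symmetric. Theory seat memo ROTOR-THEORY-9 §130. [folklore] -/
theorem pairMass_sub_pairMass (a : (V → Fin 2) → ℝ) (x y : V) (hxy : x ≠ y) :
    pairMass a x y - pairMass a y x = siteDensity a x - siteDensity a y := by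
  rw [pairMass_eq_particle a x y hxy, pairMass_eq_particle a y x hxy.symm]
  unfold siteDensity
  have h01 : ∀ i : Fin 2, i = 0 ∨ i = 1 := by decide
  have hx : ∀ σ : V → Fin 2, (if σ x = 0 then a σ ^ 2 else (0:ℝ))
      = (if σ x = 0 ∧ σ y = 1 then a σ ^ 2 else 0) + (if σ x = 0 ∧ σ y = 0 then a σ ^ 2 else 0) := by
    intro σ
    rcases h01 (σ x) with h | h <;> rcases h01 (σ y) with h' | h' <;> simp [h, h']
  have hy : ∀ σ : V → Fin 2, (if σ y = 0 then a σ ^ 2 else (0:ℝ))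
      = (if σ y = 0 ∧ σ x = 1 then a σ ^ 2 else 0) + (if σ x = 0 ∧ σ y = 0 then a σ ^ 2 else 0) := by
    intro σ
    rcases h01 (σ x) with h | h <;> rcases h01 (σ y) with h' | h' <;> simp [h, h']
  rw [Finset.sum_congr rfl fun σ _ => hx σ, Finset.sum_congr rfl fun σ _ => hy σ,
    Finset.sum_add_distrib, Finset.sum_add_distrib]
  ring

/-- Uniform site density ⇒ symmetric pair masses. [folklore] -/
theorem pairMass_symm_of_siteDensity (a : (V → Fin 2) → ℝ) (ρ : ℝ) (hdens : ∀ x, siteDensity a x = ρ)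
    (x y : V) : pairMass a x y = pairMass a y x := by
  by_cases hxy : x = y
  · subst hxy; rfl
  · have h := pairMass_sub_pairMass a x y hxy
    rw [hdens x, hdens y, sub_self] at h
    linarith

/-- **THEOREM E-FLOOR′, uniform-density form** (hypotheses in the tree's currency: non-negative `N`-sector
amplitude, `Σ ψ² = 1`, uniform site density, teleportation-support symmetry, `KL(ν_x^{(y)} ‖ ν_y^{(x)}) ≤ K`).
Theory seat memo ROTOR-THEORY-9 §130. [folklore] -/
theorem condensateDensity_ge_of_teleEntropy' [Nonempty V] (a : (V → Fin 2) → ℝ) (N ρ K : ℝ)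
    (hN : ∀ σ, 0 ≤ a σ) (h1 : ∑ σ, a σ ^ 2 = 1)
    (hsect : ∀ σ, a σ ≠ 0 → ((univ.filter fun z => σ z = 0).card : ℝ) = N)
    (hdens : ∀ x, siteDensity a x = ρ)
    (hac : ∀ x y τ, x ≠ y → 0 < teleLaw a x y τ → 0 < teleLaw a y x τ)
    (hK : ∀ x y, x ≠ y → klDiv (teleLaw a x y) (teleLaw a y x) ≤ K) :
    (N / Fintype.card V) * (1 - N / Fintype.card V) * Real.exp (-K / 2)
      ≤ condensateDensity a :=
  condensateDensity_ge_of_teleEntropy a N K hN h1 hsect (pairMass_symm_of_siteDensity a ρ hdens) hac hK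

end OneState

end Summit.HubbardSuperconductivity.HubbardSuperconductivity.Theorems.AnisotropyChord.InsertionEntropy
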